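import Summits.Parity.GeneralizedHardyLittlewood.Theorems.LeeYangFibresRelativeDimOneMoebiusSplitDefs
import Literature.NumberTheory.Sieve.GoldstonYildirimLemma21LogJ1Proofs
import HarnessLib

/-!
# Crux `RelativeDimOne` (stmt-Parity-14113), line `single-moebius-split`, stub `stub_truncSingularSeries`:
# auxiliary file 1 — the general twisted one-variable Goldston–Yıldırım lemma, algebraic half

For a "prime twist" `w : ℕ → ℝ` the one-variable Goldston–Yıldırım sum is
`Σ_w(u) = ∑_{e ≤ u} μ(e) log(u/e) ∏_{p ∣ e} w(p)` (GY-I, Integers 3 (2003) A5, Lemma 2.1: `w(p) = [p ∤ k]/p`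
is its case `j = 0`, main term `k/φ(k)`; the general twist `p w(p) = 1 + O(1/p)` is what the iterated
`t`-variable singular series of the line needs). THIS FILE: the algebra, with no new definitions — the
arithmetic functions `G(n) = μ(n) ∏_{p∣n} p w(p)`, `H(n) = ∏_{p∣n} (1 − p w(p))`, `F(n) = H(n)/n` are Mathlib's
`prodPrimeFactors`/`pmul`/`pdiv`, passed to the lemmas through defining hypotheses `hG`, `hH`, `hF`:

* `G = H ⋆ μ` (comparison on prime powers), hence the hyperbola identity
  `Σ_w(u) = ∑_{d ≤ u} F(d) · M₁(u/d)`, `M₁(v) = ∑_{m ≤ v} μ(m)/m log(v/m)` (`tss_hyperbola`, registered);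
* the main term `∑_{d ≤ u} F(d)` against the truncated Euler product `∏_{p<y} ∑_{j ≤ J} F(p^j)` (`y > u`):
  the difference is a sum over divisors `d > u` of `∏_{p<y} p^J`, bounded by a `d^{1/2}`-Rankin moment
  (`abs_sum_F_sub_prod_le`), and the moments `∑ |F|`, `∑ |F| √·` are bounded by finite Euler products;
* the local sums `∑_{j ≤ J} F(p^j)` are geometric with limit `(1 − w(p)) p/(p−1)`.

References: D. A. Goldston, C. Y. Yıldırım, Integers 3 (2003) A5 = arXiv:math/0111212, Lemma 2.1 and (3.1)
[GoldstonYildirim2001]; B. Green, T. Tao, Ann. of Math. 171 (2010), App. D [GreenTao2010].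
-/

noncomputable section

open Finset Real ArithmeticFunction
open scoped ArithmeticFunction.Moebius ArithmeticFunction.zeta

namespace Summit.Parity.GeneralizedHardyLittlewood.Cruxes.RelativeDimOne.SingleMoebiusSplit

namespace TSSGtl

open Literature.NumberTheory.Sieve

variable {w : ℕ → ℝ} {G H F : ArithmeticFunction ℝ}

/-! ### The convolution identity `G = H ⋆ μ` -/

/-- `G(e) = μ(e) ∏_{p ∣ e} p w(p)` for `e ≠ 0`. [folklore] -/
theorem G_apply (hG : G = ArithmeticFunction.pmul (μ : ArithmeticFunction ℝ)
      (prodPrimeFactors fun p : ℕ => (p : ℝ) * w p)) {e : ℕ} (he : e ≠ 0) :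
    G e = (μ e : ℝ) * ∏ p ∈ e.primeFactors, (p : ℝ) * w p := by
  rw [hG, pmul_apply, intCoe_apply, prodPrimeFactors_apply he]

/-- `G(e)/e = μ(e) ∏_{p ∣ e} w(p)` for `e ≠ 0` (`∏_{p ∣ e} p = e` for square-free `e`, `μ(e) = 0` otherwise).
[folklore] -/
theorem G_apply_div (hG : G = ArithmeticFunction.pmul (μ : ArithmeticFunction ℝ)
      (prodPrimeFactors fun p : ℕ => (p : ℝ) * w p)) {e : ℕ} (he : e ≠ 0) :
    G e / e = (μ e : ℝ) * ∏ p ∈ e.primeFactors, w p := by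
  rw [G_apply hG he]
  by_cases hsq : Squarefree e
  · rw [prod_mul_distrib]
    have h1 : (∏ p ∈ e.primeFactors, (p : ℝ)) = e := by
      rw [← Nat.cast_prod, Nat.prod_primeFactors_of_squarefree hsq]
    rw [h1]
    have he' : (e : ℝ) ≠ 0 := by exact_mod_cast he
    field_simp
  · rw [moebius_eq_zero_of_not_squarefree hsq]
    simp

/-- `H(p^j) = 1 − p w(p)` for `j ≥ 1`. [folklore] -/
theorem H_apply_prime_pow (hH : H = prodPrimeFactors fun p : ℕ => (1 : ℝ) - p * w p) {p j : ℕ}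
    (hp : p.Prime) (hj : j ≠ 0) : H (p ^ j) = 1 - (p : ℝ) * w p := by
  rw [hH, prodPrimeFactors_apply (pow_ne_zero _ hp.ne_zero), Nat.primeFactors_prime_pow hj hp,
    prod_singleton]

/-- `H` is multiplicative. [folklore] -/
theorem isMultiplicative_H (hH : H = prodPrimeFactors fun p : ℕ => (1 : ℝ) - p * w p) :
    IsMultiplicative H := by
  rw [hH]; exact IsMultiplicative.prodPrimeFactors _

/-- **`G = H ⋆ μ`** (both sides are multiplicative; on prime powers
`(H ⋆ μ)(p^j) = H(p^j) − H(p^{j−1})` is `−p w(p)` for `j = 1` and `0` for `j ≥ 2`).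
[cite: GoldstonYildirim2001, (3.1)] -/
theorem G_eq_H_mul_moebius (hG : G = ArithmeticFunction.pmul (μ : ArithmeticFunction ℝ)
      (prodPrimeFactors fun p : ℕ => (p : ℝ) * w p))
    (hH : H = prodPrimeFactors fun p : ℕ => (1 : ℝ) - p * w p) :
    G = H * (μ : ArithmeticFunction ℝ) := by
  have hGm : IsMultiplicative G := by
    rw [hG]; exact isMultiplicative_moebius.intCast.pmul (IsMultiplicative.prodPrimeFactors _)
  rw [hGm.eq_iff_eq_on_prime_powers _ _ ((isMultiplicative_H hH).mul isMultiplicative_moebius.intCast)]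
  intro p j hp
  rcases Nat.eq_zero_or_pos j with rfl | hj
  · rw [pow_zero, hGm.map_one, ((isMultiplicative_H hH).mul isMultiplicative_moebius.intCast).map_one]
  rw [G_apply hG (pow_ne_zero _ hp.ne_zero), moebius_apply_prime_pow hp hj.ne',
    Nat.primeFactors_prime_pow hj.ne' hp, prod_singleton, SquarefreeSums.mul_apply_prime_pow _ _ hp]
  -- peel off the terms `i = j` and `i = j - 1`; the others vanish (`μ(p^k) = 0` for `k ≥ 2`)
  obtain ⟨j', rfl⟩ := Nat.exists_eq_succ_of_ne_zero hj.ne'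
  rw [Finset.sum_range_succ, Finset.sum_range_succ]
  have hrest : ∑ i ∈ Finset.range j', H (p ^ i) * (μ : ArithmeticFunction ℝ) (p ^ (j' + 1 - i)) = 0 := by
    refine Finset.sum_eq_zero fun i hi => ?_
    rw [Finset.mem_range] at hi
    rw [intCoe_apply, moebius_apply_prime_pow hp (by omega), if_neg (by omega)]
    simp
  rw [hrest, zero_add, intCoe_apply, intCoe_apply, show j' + 1 - j' = 1 by omega, pow_one,
    moebius_apply_prime hp, Nat.sub_self, pow_zero, moebius_apply_one,
    H_apply_prime_pow hH hp (Nat.succ_ne_zero j')]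
  rcases Nat.eq_zero_or_pos j' with rfl | hj'
  · rw [pow_zero, (isMultiplicative_H hH).map_one, if_pos rfl]
    push_cast
    ring
  · rw [H_apply_prime_pow hH hp hj'.ne', if_neg (by omega)]
    push_cast
    ring

/-! ### `F = H/id`: values, multiplicativity, local sums -/

/-- `F(n) = H(n)/n`. [folklore] -/
theorem F_apply (hF : F = H.pdiv ((ArithmeticFunction.id : ArithmeticFunction ℕ) : ArithmeticFunction ℝ))
    (n : ℕ) : F n = H n / n := by
  rw [hF, pdiv_apply, natCoe_apply, id_apply]

/-- `F` is multiplicative. [folklore] -/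
theorem isMultiplicative_F (hH : H = prodPrimeFactors fun p : ℕ => (1 : ℝ) - p * w p)
    (hF : F = H.pdiv ((ArithmeticFunction.id : ArithmeticFunction ℕ) : ArithmeticFunction ℝ)) :
    IsMultiplicative F := by
  rw [hF]; exact (isMultiplicative_H hH).pdiv isMultiplicative_id.natCast

/-- `F(p^j) = (1 − p w(p)) p^{-j}` for `j ≥ 1`. [folklore] -/
theorem F_apply_prime_pow (hH : H = prodPrimeFactors fun p : ℕ => (1 : ℝ) - p * w p)
    (hF : F = H.pdiv ((ArithmeticFunction.id : ArithmeticFunction ℕ) : ArithmeticFunction ℝ))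
    {p j : ℕ} (hp : p.Prime) (hj : j ≠ 0) : F (p ^ j) = (1 - (p : ℝ) * w p) * ((p : ℝ)⁻¹) ^ j := by
  rw [F_apply hF, H_apply_prime_pow hH hp hj, div_eq_mul_inv, Nat.cast_pow, inv_pow]

/-- `∑_{j ≤ J} F(p^j) = 1 + (1 − p w(p)) p⁻¹ ∑_{j < J} p^{-j}`. [folklore] -/
theorem sum_F_prime_pow_eq (hH : H = prodPrimeFactors fun p : ℕ => (1 : ℝ) - p * w p)
    (hF : F = H.pdiv ((ArithmeticFunction.id : ArithmeticFunction ℕ) : ArithmeticFunction ℝ))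
    {p : ℕ} (hp : p.Prime) (J : ℕ) :
    ∑ j ∈ Finset.range (J + 1), F (p ^ j) =
      1 + (1 - (p : ℝ) * w p) * ((p : ℝ)⁻¹ * ∑ j ∈ Finset.range J, ((p : ℝ)⁻¹) ^ j) := by
  rw [Finset.sum_range_succ', pow_zero, (isMultiplicative_F hH hF).map_one, add_comm, Finset.mul_sum,
    Finset.mul_sum]
  congr 1
  refine Finset.sum_congr rfl fun j _ => ?_
  rw [F_apply_prime_pow hH hF hp (Nat.succ_ne_zero j), pow_succ]
  ring

/-- The Euler factor: `∑_{j ≤ J} F(p^j) → 1 + (1 − p w(p))/(p − 1) = (1 − w(p)) p/(p−1)` as `J → ∞`. [folklore] -/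
theorem tendsto_sum_F_prime_pow (hH : H = prodPrimeFactors fun p : ℕ => (1 : ℝ) - p * w p)
    (hF : F = H.pdiv ((ArithmeticFunction.id : ArithmeticFunction ℕ) : ArithmeticFunction ℝ))
    {p : ℕ} (hp : p.Prime) :
    Filter.Tendsto (fun J => ∑ j ∈ Finset.range (J + 1), F (p ^ j)) Filter.atTop
      (nhds ((1 - w p) * ((p : ℝ) / ((p : ℝ) - 1)))) := by
  have hp2 : (2 : ℝ) ≤ p := by exact_mod_cast hp.two_le
  have hp0 : (p : ℝ) ≠ 0 := by positivity
  have hp1 : (p : ℝ) - 1 ≠ 0 := by linarith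
  have hr0 : 0 ≤ (p : ℝ)⁻¹ := by positivity
  have hr1 : (p : ℝ)⁻¹ < 1 := inv_lt_one_of_one_lt₀ (by linarith)
  have hgeo := (hasSum_geometric_of_lt_one hr0 hr1).tendsto_sum_nat
  have hlim : (1 - w p) * ((p : ℝ) / ((p : ℝ) - 1)) =
      1 + (1 - (p : ℝ) * w p) * ((p : ℝ)⁻¹ * (1 - (p : ℝ)⁻¹)⁻¹) := by
    field_simp
    ring
  rw [hlim]
  simp_rw [sum_F_prime_pow_eq hH hF hp]
  exact tendsto_const_nhds.add (tendsto_const_nhds.mul (tendsto_const_nhds.mul hgeo))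

/-- `∑_{j ≤ J} |F(p^j)| ≤ 1 + |1 − p w(p)|/(p − 1)`. [folklore] -/
theorem sum_abs_F_prime_pow_le (hH : H = prodPrimeFactors fun p : ℕ => (1 : ℝ) - p * w p)
    (hF : F = H.pdiv ((ArithmeticFunction.id : ArithmeticFunction ℕ) : ArithmeticFunction ℝ))
    {p : ℕ} (hp : p.Prime) (J : ℕ) :
    ∑ j ∈ Finset.range (J + 1), |F (p ^ j)| ≤ 1 + |1 - (p : ℝ) * w p| / ((p : ℝ) - 1) := by
  have hp2 : (2 : ℝ) ≤ p := by exact_mod_cast hp.two_le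
  have hp0 : (p : ℝ) ≠ 0 := by positivity
  have hp1 : 0 < (p : ℝ) - 1 := by linarith
  have hr0 : 0 ≤ (p : ℝ)⁻¹ := by positivity
  have hr1 : (p : ℝ)⁻¹ < 1 := inv_lt_one_of_one_lt₀ (by linarith)
  rw [Finset.range_eq_Ico, Finset.sum_eq_sum_Ico_succ_bot (Nat.succ_pos J), pow_zero,
    (isMultiplicative_F hH hF).map_one, abs_one]
  apply add_le_add le_rfl
  rw [Finset.sum_congr rfl fun j hj => by
    rw [F_apply_prime_pow hH hF hp (by have := (Finset.mem_Ico.1 hj).1; omega), abs_mul, abs_pow,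
      abs_of_nonneg hr0], ← Finset.mul_sum]
  calc |1 - (p : ℝ) * w p| * ∑ j ∈ Ico 1 (J + 1), ((p : ℝ)⁻¹) ^ j
      ≤ |1 - (p : ℝ) * w p| * (((p : ℝ)⁻¹) ^ 1 / (1 - (p : ℝ)⁻¹)) :=
        mul_le_mul_of_nonneg_left (geom_sum_Ico_le_of_lt_one hr0 hr1) (abs_nonneg _)
    _ = |1 - (p : ℝ) * w p| / ((p : ℝ) - 1) := by
        field_simp

/-- `∑_{j ≤ J} |F(p^j)| √(p^j) ≤ 1 + |1 − p w(p)| · 4 p^{-1/2}` (`∑_{j ≥ 1} p^{-j/2} = 1/(√p − 1) ≤ 4/√p`).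
[folklore] -/
theorem sum_absSqrt_F_prime_pow_le (hH : H = prodPrimeFactors fun p : ℕ => (1 : ℝ) - p * w p)
    (hF : F = H.pdiv ((ArithmeticFunction.id : ArithmeticFunction ℕ) : ArithmeticFunction ℝ))
    {p : ℕ} (hp : p.Prime) (J : ℕ) :
    ∑ j ∈ Finset.range (J + 1), |F (p ^ j)| * Real.sqrt ((p ^ j : ℕ) : ℝ) ≤
      1 + |1 - (p : ℝ) * w p| * (4 * (p : ℝ) ^ (-(1 / 2 : ℝ))) := by
  have hp2 : (2 : ℝ) ≤ p := by exact_mod_cast hp.two_le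
  have hp0 : (0 : ℝ) < p := by linarith
  have hs2 : Real.sqrt 2 ≤ Real.sqrt p := Real.sqrt_le_sqrt hp2
  have hsqrt2 : (4 : ℝ) / 3 ≤ Real.sqrt 2 := by
    rw [show (4 : ℝ) / 3 = Real.sqrt ((4 / 3) ^ 2) by rw [Real.sqrt_sq (by norm_num)]]
    exact Real.sqrt_le_sqrt (by norm_num)
  have hs1 : 1 < Real.sqrt p := by linarith
  have hs0 : 0 < Real.sqrt p := by linarith
  have hr0 : 0 ≤ (Real.sqrt p)⁻¹ := by positivity
  have hr1 : (Real.sqrt p)⁻¹ < 1 := inv_lt_one_of_one_lt₀ hs1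
  have hterm : ∀ j, j ≠ 0 → |F (p ^ j)| * Real.sqrt (((p ^ j : ℕ) : ℝ)) =
      |1 - (p : ℝ) * w p| * ((Real.sqrt p)⁻¹) ^ j := by
    intro j hj
    rw [F_apply_prime_pow hH hF hp hj, abs_mul, abs_pow, abs_of_nonneg (by positivity : (0 : ℝ) ≤ (p : ℝ)⁻¹),
      GoldstonYildirimLemma21.sqrt_natCast_pow, mul_assoc, ← mul_pow]
    congr 2
    rw [show ((p : ℝ))⁻¹ = (Real.sqrt p)⁻¹ * (Real.sqrt p)⁻¹ by
      rw [← mul_inv, Real.mul_self_sqrt hp0.le]]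
    field_simp
  rw [Finset.range_eq_Ico, Finset.sum_eq_sum_Ico_succ_bot (Nat.succ_pos J), pow_zero,
    (isMultiplicative_F hH hF).map_one, abs_one, Nat.cast_one, Real.sqrt_one, one_mul]
  apply add_le_add le_rfl
  rw [Finset.sum_congr rfl fun j hj => hterm j (by have := (Finset.mem_Ico.1 hj).1; omega),
    ← Finset.mul_sum]
  refine mul_le_mul_of_nonneg_left ?_ (abs_nonneg _)
  calc ∑ j ∈ Ico 1 (J + 1), ((Real.sqrt p)⁻¹) ^ j ≤ ((Real.sqrt p)⁻¹) ^ 1 / (1 - (Real.sqrt p)⁻¹) :=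
        geom_sum_Ico_le_of_lt_one hr0 hr1
    _ = 1 / (Real.sqrt p - 1) := by field_simp
    _ ≤ 4 / Real.sqrt p := by
        rw [div_le_div_iff₀ (by linarith) hs0]
        linarith
    _ = 4 * (p : ℝ) ^ (-(1 / 2 : ℝ)) := by
        rw [Real.rpow_neg hp0.le, ← Real.sqrt_eq_rpow, div_eq_mul_inv]

/-! ### Euler products over finite sets of primes; the truncated main term -/

/-- For a multiplicative `f` and a finite set of primes `P`: `∑_{d ∣ ∏_{p ∈ P} p^J} f(d) = ∏_{p ∈ P} ∑_{j ≤ J} f(p^j)`.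
[folklore] -/
theorem sum_divisors_prod_pow_eq {f : ArithmeticFunction ℝ} (hf : f.IsMultiplicative) (P : Finset ℕ)
    (hP : ∀ p ∈ P, p.Prime) (J : ℕ) :
    ∑ d ∈ (∏ p ∈ P, p ^ J).divisors, f d = ∏ p ∈ P, ∑ j ∈ Finset.range (J + 1), f (p ^ j) := by
  have hζ : ((ζ : ArithmeticFunction ℕ) : ArithmeticFunction ℝ).IsMultiplicative :=
    isMultiplicative_zeta.natCast
  rw [← ArithmeticFunction.coe_mul_zeta_apply, (hf.mul hζ).map_prod (fun p => p ^ J) P]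
  · refine Finset.prod_congr rfl fun p hp => ?_
    rw [ArithmeticFunction.coe_mul_zeta_apply, Nat.sum_divisors_prime_pow (hP p hp)]
  · intro p hp q hq hne
    exact ((Nat.coprime_primes (hP p hp) (hP q hq)).2 hne).pow J J

/-- Every `1 ≤ d ≤ U` divides `∏_{p < y} p^U` when `U < y`. [folklore] -/
theorem dvd_prod_pow_of_mem_Icc {U y d : ℕ} (hy : U < y) (hd : d ∈ Icc 1 U) :
    d ∣ ∏ p ∈ Nat.primesBelow y, p ^ U := by
  obtain ⟨hd1, hdU⟩ := Finset.mem_Icc.1 hd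
  have hd0 : d ≠ 0 := by omega
  conv_lhs => rw [← Nat.prod_factorization_pow_eq_self hd0]
  have hsub : d.primeFactors ⊆ Nat.primesBelow y := fun p hp =>
    Nat.mem_primesBelow.2 ⟨lt_of_le_of_lt ((Nat.le_of_mem_primeFactors hp).trans hdU) hy,
      Nat.prime_of_mem_primeFactors hp⟩
  calc d.factorization.prod (fun p k => p ^ k) = ∏ p ∈ d.primeFactors, p ^ d.factorization p := by
        rw [Finsupp.prod, Nat.support_factorization]
    _ ∣ ∏ p ∈ d.primeFactors, p ^ U := Finset.prod_dvd_prod_of_dvd _ _ fun p _ =>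
        pow_dvd_pow p ((Nat.factorization_lt p hd0).le.trans hdU)
    _ ∣ _ := Finset.prod_dvd_prod_of_subset _ _ _ hsub

/-- **Euler truncation of the main term.** For a multiplicative real `F`, `y > U` and `J ≥ U`:
`|∑_{d ≤ U} F(d) − ∏_{p<y} ∑_{j ≤ J} F(p^j)| ≤ (U+1)^{-1/2} ∏_{p<y} ∑_{j≤J} |F(p^j)| √(p^j)`
(the difference is the sum of `F` over the divisors `d > U` of `∏_{p<y} p^J`, where `1 ≤ √d/√(U+1)`). [folklore] -/
theorem abs_sum_F_sub_prod_le (hFm : IsMultiplicative F) (U y J : ℕ) (hy : U < y) (hJ : U ≤ J) :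
    |∑ d ∈ Icc 1 U, F d - ∏ p ∈ Nat.primesBelow y, ∑ j ∈ Finset.range (J + 1), F (p ^ j)| ≤
      (Real.sqrt (U + 1))⁻¹ *
        ∏ p ∈ Nat.primesBelow y, ∑ j ∈ Finset.range (J + 1), |F (p ^ j)| * Real.sqrt ((p ^ j : ℕ) : ℝ) := by
  have hP : ∀ p ∈ Nat.primesBelow y, p.Prime := fun p hp => (Nat.mem_primesBelow.1 hp).2
  set N := ∏ p ∈ Nat.primesBelow y, p ^ J with hN
  have hN0 : N ≠ 0 := Finset.prod_ne_zero_iff.2 fun p hp => pow_ne_zero _ (hP p hp).ne_zero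
  have hsub : Icc 1 U ⊆ N.divisors := by
    intro d hd
    refine Nat.mem_divisors.2 ⟨?_, hN0⟩
    exact (dvd_prod_pow_of_mem_Icc hy hd).trans (Finset.prod_dvd_prod_of_dvd _ _ fun p _ => pow_dvd_pow p hJ)
  -- the multiplicative function `|F| √·`
  let Fs : ArithmeticFunction ℝ := ⟨fun n => |F n| * Real.sqrt n, by simp⟩
  have hFs : IsMultiplicative Fs := by
    refine ⟨?_, fun {m n} hmn => ?_⟩
    · show |F 1| * Real.sqrt ((1 : ℕ) : ℝ) = 1
      rw [hFm.map_one]; simp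
    · show |F (m * n)| * Real.sqrt ((m * n : ℕ) : ℝ) = |F m| * Real.sqrt (m : ℝ) * (|F n| * Real.sqrt (n : ℝ))
      rw [hFm.map_mul_of_coprime hmn, abs_mul, Nat.cast_mul, Real.sqrt_mul (Nat.cast_nonneg _)]
      ring
  rw [← sum_divisors_prod_pow_eq hFm _ hP J]
  have hsq := sum_divisors_prod_pow_eq hFs _ hP J
  simp only [Fs, ArithmeticFunction.coe_mk] at hsq
  rw [← hsq, ← hN, ← Finset.sum_sdiff hsub, show ∀ a b : ℝ, a - (b + a) = -b from fun a b => by ring,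
    abs_neg]
  have hU1 : 0 < Real.sqrt (U + 1) := Real.sqrt_pos.2 (by positivity)
  calc |∑ d ∈ N.divisors \ Icc 1 U, F d| ≤ ∑ d ∈ N.divisors \ Icc 1 U, |F d| := Finset.abs_sum_le_sum_abs _ _
    _ ≤ ∑ d ∈ N.divisors \ Icc 1 U, (Real.sqrt (U + 1))⁻¹ * (|F d| * Real.sqrt d) := by
        refine Finset.sum_le_sum fun d hd => ?_
        obtain ⟨hdN, hdI⟩ := Finset.mem_sdiff.1 hd
        have hd1 : 1 ≤ d := Nat.pos_of_mem_divisors hdN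
        have hdU : (U + 1 : ℝ) ≤ d := by
          have : ¬ d ≤ U := fun h => hdI (Finset.mem_Icc.2 ⟨hd1, h⟩)
          exact_mod_cast (by omega : U + 1 ≤ d)
        rw [← mul_assoc, mul_comm _ (|F d|), mul_assoc]
        refine le_mul_of_one_le_right (abs_nonneg _) ?_
        rw [inv_mul_eq_div, one_le_div hU1]
        exact Real.sqrt_le_sqrt hdU
    _ = (Real.sqrt (U + 1))⁻¹ * ∑ d ∈ N.divisors \ Icc 1 U, |F d| * Real.sqrt d := by rw [Finset.mul_sum]
    _ ≤ (Real.sqrt (U + 1))⁻¹ * ∑ d ∈ N.divisors, |F d| * Real.sqrt d := by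
        refine mul_le_mul_of_nonneg_left ?_ (inv_nonneg.2 hU1.le)
        exact Finset.sum_le_sum_of_subset_of_nonneg Finset.sdiff_subset fun _ _ _ => by positivity

/-- `∑_{d ≤ U} |F(d)| ≤ ∏_{p ≤ U} ∑_{j ≤ U} |F(p^j)|` for a multiplicative `F`. [folklore] -/
theorem sum_abs_F_le (hFm : IsMultiplicative F) (U : ℕ) :
    ∑ d ∈ Icc 1 U, |F d| ≤ ∏ p ∈ Nat.primesBelow (U + 1), ∑ j ∈ Finset.range (U + 1), |F (p ^ j)| := by
  let Fa : ArithmeticFunction ℝ := ⟨fun n => |F n|, by simp⟩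
  have hFa : IsMultiplicative Fa := by
    refine ⟨?_, fun {m n} hmn => ?_⟩
    · show |F 1| = 1
      rw [hFm.map_one, abs_one]
    · show |F (m * n)| = |F m| * |F n|
      rw [hFm.map_mul_of_coprime hmn, abs_mul]
  have := SquarefreeSums.sum_le_prod_sum_prime_pow hFa (fun n => show (0 : ℝ) ≤ |F n| from abs_nonneg _) U
  simpa only [Fa, ArithmeticFunction.coe_mk] using this

/-- `∑_{d ≤ U} |F(d)| √d ≤ ∏_{p ≤ U} ∑_{j ≤ U} |F(p^j)| √(p^j)` for a multiplicative `F`. [folklore] -/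
theorem sum_absSqrt_F_le (hFm : IsMultiplicative F) (U : ℕ) :
    ∑ d ∈ Icc 1 U, |F d| * Real.sqrt d ≤
      ∏ p ∈ Nat.primesBelow (U + 1), ∑ j ∈ Finset.range (U + 1), |F (p ^ j)| * Real.sqrt ((p ^ j : ℕ) : ℝ) := by
  let Fs : ArithmeticFunction ℝ := ⟨fun n => |F n| * Real.sqrt n, by simp⟩
  have hFs : IsMultiplicative Fs := by
    refine ⟨?_, fun {m n} hmn => ?_⟩
    · show |F 1| * Real.sqrt ((1 : ℕ) : ℝ) = 1
      rw [hFm.map_one]; simp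
    · show |F (m * n)| * Real.sqrt ((m * n : ℕ) : ℝ) = |F m| * Real.sqrt (m : ℝ) * (|F n| * Real.sqrt (n : ℝ))
      rw [hFm.map_mul_of_coprime hmn, abs_mul, Nat.cast_mul, Real.sqrt_mul (Nat.cast_nonneg _)]
      ring
  have := SquarefreeSums.sum_le_prod_sum_prime_pow hFs
    (fun n => show (0 : ℝ) ≤ |F n| * Real.sqrt n from by positivity) U
  simpa only [Fs, ArithmeticFunction.coe_mk] using this

end TSSGtl

/-! ### The registered sub-goal of this file: the hyperbola identity -/

open Literature.NumberTheory.Sieve in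
/-- **Hyperbola identity for the twisted Goldston–Yıldırım sum** (sub-goal `tss_hyperbola` of
`stub_truncSingularSeries`): for every prime twist `w` and every `u`,
`∑_{e ≤ u} μ(e) log(u/e) ∏_{p ∣ e} w(p) = ∑_{d ≤ u} H_w(d)/d · M₁(u/d)` with `H_w = ∏_{p ∣ d}(1 − p w(p))`
(Mathlib's `prodPrimeFactors`) and `M₁(v) = ∑_{m ≤ v} μ(m)/m log(v/m)` (`GreenTao2008.moebiusLogSum`) — Dirichlet's
rearrangement of `G = H ⋆ μ`. [cite: GoldstonYildirim2001, (3.1)–(3.2)] -/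
theorem tss_hyperbola : ∀ (w : ℕ → ℝ) (u : ℝ),
    ∑ e ∈ Finset.Icc 1 ⌊u⌋₊, ((ArithmeticFunction.moebius e : ℤ) : ℝ) * Real.log (u / e) *
        ∏ p ∈ e.primeFactors, w p =
      ∑ d ∈ Finset.Icc 1 ⌊u⌋₊, (ArithmeticFunction.prodPrimeFactors (fun p : ℕ => (1 : ℝ) - p * w p)) d / d *
        Literature.NumberTheory.Sieve.GreenTao2008.moebiusLogSum (u / d) := by
  intro w u
  set G : ArithmeticFunction ℝ := ArithmeticFunction.pmul (μ : ArithmeticFunction ℝ)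
    (prodPrimeFactors fun p : ℕ => (p : ℝ) * w p) with hG
  set H : ArithmeticFunction ℝ := prodPrimeFactors fun p : ℕ => (1 : ℝ) - p * w p with hH
  have h1 : ∀ e ∈ Icc 1 ⌊u⌋₊, (μ e : ℝ) * Real.log (u / e) * ∏ p ∈ e.primeFactors, w p =
      ∑ q ∈ e.divisorsAntidiagonal, H q.1 / q.1 * ((μ q.2 : ℝ) / q.2 * Real.log (u / q.1 / q.2)) := by
    intro e he
    have he0 : e ≠ 0 := by have := (Finset.mem_Icc.mp he).1; omega
    have h2 : (μ e : ℝ) * ∏ p ∈ e.primeFactors, w p = G e / e := (TSSGtl.G_apply_div hG he0).symm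
    rw [mul_assoc, mul_comm (Real.log _), ← mul_assoc, h2, TSSGtl.G_eq_H_mul_moebius hG hH, mul_apply,
      Finset.sum_div, Finset.sum_mul]
    refine Finset.sum_congr rfl fun q hq => ?_
    rw [Nat.mem_divisorsAntidiagonal] at hq
    have : (e : ℝ) = q.1 * q.2 := by rw [← hq.1]; push_cast; ring
    rw [this, ← div_div, intCoe_apply]
    have hq1 : (q.1 : ℝ) ≠ 0 := by
      have : q.1 ≠ 0 := fun h => hq.2 (by rw [← hq.1, h, zero_mul])
      exact_mod_cast this
    have hq2 : (q.2 : ℝ) ≠ 0 := by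
      have : q.2 ≠ 0 := fun h => hq.2 (by rw [← hq.1, h, mul_zero])
      exact_mod_cast this
    field_simp
  rw [Finset.sum_congr rfl h1, SquarefreeSums.sum_Icc_sum_divisorsAntidiagonal
    (fun d m => H d / d * ((μ m : ℝ) / m * Real.log (u / d / m))) ⌊u⌋₊]
  refine Finset.sum_congr rfl fun d _ => ?_
  rw [← Finset.mul_sum, GreenTao2008.moebiusLogSum_def, Nat.floor_div_natCast]

end Summit.Parity.GeneralizedHardyLittlewood.Cruxes.RelativeDimOne.SingleMoebiusSplit

end
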